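import Summits.QuantumFields.YangMills.Theorems.BalabanUVNodesK0RecordFormatNamesLocD
import Summits.QuantumFields.YangMills.Theorems.BalabanUVNodesRootedGaugeCentred

/-!
# K0⁷ — THE RECORD-SIDE FORMAT NAMES, EDITION 18 = THE CENTRED RESPONSE NAMES (director-ym №515 (4), EXIT (α) second file):
# `recordBgFieldC ∕ recordDC ∕ recordHrC ∕ recordGkLC` — ed.9 ∕ ed.14's rooted objects RE-CENTRED through `RootedGaugeCentred.rootGaugeC`

Cell `ym-nodeO-ideate` ∕ `ym-balaban-port`, DEFINER seat `ym-nodeO-def-1` (gen 35); `--kind definition --supports stmt-QuantumFields-20541 --as helper`; count-neutral.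
[I] = [Balaban1987RG1], [15] = [Balaban1985Variational].

WHY.  W-wrap (DEF-1 g35 «TUBE TERM», ◆ CRIT-1 g35 R-CRIT1-g35-2, ★★★ №515): the record's background `recordBgField B = UkSel … (unitField B)` is read in the WRAPPING normal form
`T4RootedResidualGauge.rootGauge (k+1)`; its linearised response `recordD` and the (21)-Landau representative `recordHr` (ed.14) inherit a non-decaying `O(ξ)` pure-gauge tube term from
the wrapped half-windings (one-volume decay tokens on them are FALSE-SHAPED given HypAn — J5∕S-wrap).  EXIT (α): the CENTRED normal form `RootedGaugeCentred.rootGaugeC` (signed in-block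
comb; `rootGaugeC_rootGauge`: re-centring the wrapping form gives the centred form, so NO selector is re-pointed).  THIS FILE names the centred analogues of ed.9's `recordBgField`,
ed.14's `recordD ∕ recordHr ∕ recordGkL` — the objects on which ‴-type one-volume decay is PLAUSIBLY true-shaped (◆'s centred control run, d = 2 one level: `|Hr − ξ·hOp|_max`
0.2420 → 0.0083, localised) — for the cutter∕porters to re-key tokens on AFTER the J4∕J5 toy table is attached (no token or receipt is cut here).

WHAT THIS FILE IS (definitions only; statement-form; NEW names; §1–§24 and the rooted objects untouched — append-only rule):
* §26a `recordBgFieldC F θ k K B := rootGaugeC (k+1) (recordBgField F θ k K B)` — the (0.21) background of the charted datum READ IN THE CENTRED NORMAL FORM (= `rootGaugeC` of ANY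
  minimiser of the record's orbit, `RootedGaugeCentred.rootGaugeC_eq_of_orbitRel`; in-block axial: `rootGaugeC_apply_of_mem_combSet`).
* §26b `recordDC` — the centred response entries (ed.14's `recordD` shape verbatim over `recordBgFieldC`); `recordHrC := landauRepC ∘ recordDC` entrywise — the (21)-Landau
  representative of the CENTRED response; `recordGkLC` — the two-block coordinates with the 𝐔-block read from `recordHrC` and the 𝐉-block `recordGkJ` unchanged (gauge-covariant
  current, as in ed.14).

HONEST FRAMING.  Definitions only; NOTHING of Bałaban is asserted, ported or discharged; no token∕row is cut on these names here (J4∕J5); the decay of `recordHrC` is [15] Prop. 9 (190)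
content (wall W-(190), XL, unported) plus the localised (0.4)-comb term (PTZ-1∕CRIT-1: small, localised in the model) — NOT asserted; `UkSel`, `recordBgField`, `recordD`, `recordHr`
and their importers are UNCHANGED; 27931 CLOSED·IMPLICATION-ONLY·IN TOTO (№515); 27930∕26648 OPEN; K0ᴬ∕K1ᴬ∕K3ᴬ OPEN; NODE O not inhabited (0∕1); COUNT 8∕28 · K 1∕4 UNMOVED;
finite `𝕋⁴_{L^K}` at fixed ε — NOT continuum ∕ ℝ⁴ ∕ OS; **the Yang–Mills mass gap (Clay) is NOT proved by any of this.**  No `sorry`, `instance`, `notation`; standard axioms.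
-/

noncomputable section

open scoped BigOperators Matrix.Norms.L2Operator

namespace Summit.QuantumFields.YangMills.Theorems.K0RecordFormatNames

open Literature.MathematicalPhysics.QuantumFieldTheory.Balaban1983to89
open Literature.MathematicalPhysics.QuantumFieldTheory.Balaban1983to89.Node00
open Literature.MathematicalPhysics.QuantumFieldTheory.Balaban1983to89.T4Continuum (T4Family)
open Summit.QuantumFields.YangMills.Theorems.RootedGaugeCentred (rootGaugeC)

variable (F : T4Family)

/-! ## §26a  The background of the charted datum in the CENTRED normal form -/

section Theta

variable (θ : Stage13Params F 2)

/-- ★ **`recordBgFieldC F θ k K B := rootGaugeC (k+1) (recordBgField F θ k K B)`** — the fine-lattice (0.21) background of the charted configuration `W_B`, READ IN THE CENTRED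
ROOTED NORMAL FORM (signed in-block comb from the `(k+1)`-block centres: print's axial paths, no torus wrap).  Equal to `rootGaugeC (k+1) U₀` for EVERY minimiser `U₀` of the
record's residual orbit (`RootedGaugeCentred.rootGaugeC_eq_of_orbitRel`, `rootGaugeC_rootGauge`); the selector `UkSel` is NOT re-pointed. [cite: Balaban1985Variational, (19) p.281, Thm 1 p.279; Balaban1987RG1, (0.21) p.256, (2.3) p.265] -/
def recordBgFieldC (k K : ℕ) (B : Fin (F.P K).d → Site (F.P K) (k + 1) → θ.Vβ) : GaugeField (F.P K) 0 (SU 2) :=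
  rootGaugeC (k + 1) (recordBgField F θ k K B)

/-! ## §26b  The centred response, its (21)-Landau representative and its two-block coordinates -/

/-- **`D^C` — `recordDC F θ k K a l b i i'`**: the derivative at `B = 0`, in the direction `δ_l ⊗ bV a`, of the `(i, i')` entry of the CENTRED background `recordBgFieldC … B b` — ed.14's
`recordD` with the centred normal form in place of the wrapping one. [cite: Balaban1985Variational, Prop. 9 p.309, (19) p.281; Balaban1987RG1, (4.35) p.290] -/
def recordDC (k K : ℕ) (a : θ.ιβ) (l : RespLabel F k K) : PBond (F.P K) 0 → Fin 2 → Fin 2 → ℂ :=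
  letI := θ.instVβ₁; letI := θ.instVβ₂; letI := θ.instιβ
  fderiv ℝ (fun B : Fin (F.P K).d → Site (F.P K) (k + 1) → θ.Vβ =>
    fun (b : PBond (F.P K) 0) (i i' : Fin 2) => ((recordBgFieldC F θ k K B b : SU 2) : Matrix (Fin 2) (Fin 2) ℂ) i i') 0
    (Pi.single l.1 (Pi.single l.2 (θ.bV a)))

/-- ★ **`Hr^C` — `recordHrC F θ k K a l b i i'`**: the (21)-LANDAU REPRESENTATIVE of the CENTRED response, entry by entry (`landauRepC ∘ recordDC`) — the object on which print's
one-volume decay (190) is stated for the axial-then-Landau representative; its difference from `ξ·H e_l·ρ₈` is the LOCALISED (0.4)-comb gauge term only (no tube term — ◆ CRIT-1 g35's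
centred control run).  Displayed-token material for the cutter, nothing asserted. [cite: Balaban1985Variational, Prop. 9 p.309, (190) p.308, (21) p.281; Balaban1987RG1, (4.35) p.290] -/
def recordHrC (k K : ℕ) (a : θ.ιβ) (l : RespLabel F k K) : PBond (F.P K) 0 → Fin 2 → Fin 2 → ℂ :=
  fun b i i' => landauRepC F k K (fun b' => recordDC F θ k K a l b' i i') b

/-- **`G_k^{LC}` — `recordGkLC F θ k K a l`**: the two-block response coordinates with the 𝐔-block READ FROM `recordHrC` and the 𝐉-block UNCHANGED (`recordGkJ`: the current is gauge-covariant
with `J(1) = 0`, so its linearisation does not see the gauge — as in ed.14's `recordGkL`). [cite: Balaban1987RG1, (4.35) p.290, (1.8)–(1.9) p.261; Balaban1985Variational, Prop. 9 p.309] -/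
def recordGkLC (k K : ℕ) (a : θ.ιβ) (l : RespLabel F k K) (i : Fin (recordChartDimJ F K)) : ℂ :=
  Sum.elim
    (fun c => sl2Coord (Matrix.of fun i₁ i₂ => recordHrC F θ k K a l ((chartEquivJ F K).symm i).1 i₁ i₂) c)
    (fun _ => recordGkJ F θ k K a l i)
    ((chartEquivJ F K).symm i).2

end Theta

end Summit.QuantumFields.YangMills.Theorems.K0RecordFormatNames

end
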